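/-
Copyright (c) 2026 the pub-hodgecm-mathlib formalisation cell (harness21).  Prover seat hodgecm-mathlib-LH4-p06 (g6), Track A «(D-RAM) FOUR-FRAME» helper lane
(`--supports stmt-HodgeConjecture-24833 --as helper`); STAGE-1b count-neutral (D-G) BRICK «(D-G-levels)» (KNOCK 2026-09-04T08:24:29Z, TAKING 08:49Z).  2026-09-04.
-/
import Summits.HodgeConjecture.HodgeConjecture.Theorems.F0P3cDyRamPieceCountDictionaryProfiles   -- ★ (B-p08 (g41)): `pieceCountDictionary_of_profile` (the generic profile dictionary); brings ★ p854742
                                                                                                 -- `isLocSmooth_indicator_profile` ∕ `indicator_profile_conj_eq` ∕ `uniformizer_facts`, ★ p854732 `inLevel_*`,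
                                                                                                 -- ★ p854719 `conj_sub_one` ∕ `inLevel_conj_iff_latticeInLevel` ∕ `reg_profile_conj_iff`, ★ p854672 census defs, ★ №3 pieces
import Literature.NumberTheory.Automorphic.UnitaryLatticeTreeTubeCollarTokens                    -- ★ `scaleLattice_pow_antitone` (`ϖ^{e'}M ≤ ϖ^e M`, `e ≤ e'`)
import HarnessLib

/-!
# Crux `H413`, line LH4 «(D-RAM) FOUR-FRAME» — STAGE-1b (D-G) BRICK: the CENSUS DICTIONARY of the UNLABELLED CONGRUENCE-PROFILE PIECES
# `𝟙_{K_{a,b}} = 𝟙{u ∈ K ∣ X ∈ ϖ^a M₃(𝒪_w), X² ∈ ϖ^b M₃(𝒪_w)}` and `𝟙{u ∈ K ∣ X² ∈ ϖ^b M₃(𝒪_w)}` (`X := wMatrix u − 1`), and the census-currency bridges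

Cell `hodgecm-mathlib` (D-0151), FLOOR 0, crux item H413 = `stmt-HodgeConjecture-24833`, route of record `HCCMUnconditional`; squad F0∕P3c∕LH4; helper lane
(count-neutral).  THEOREMS ONLY (no `def`, no instance, no notation, no `sorry`, default heartbeats).  Consumer: the STAGE-1b directive (heir LEAD F0P3a-plan ∕ dealer
LH4-plan) for the three open tier-0 rows `F0P3cDyRamFourFrame.stub_rows_transvPlus ∕ _transvMinus ∕ _regular : PieceRowsWild gselStar 1 ∕ 2 ∕ 3` of
`Cruxes/H413/Lines/F0_P3c_DyRamFourFrame.lean` (ED. 3).  Nothing here is a `Lines` edition or a registry act; no statement of the line is reworded.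

WHY.  The STAGE-1b algebra brick of F0P3a-p01 (g35) (`Theorems/F0P3cDyRamPieceRowsWildLinear.lean`, §4–§5) rewrites the debt rows `transvMinus ∕ regular` as the row
`transvPlus` ∕ `unit0` MINUS the rows of three UNLABELLED congruence-profile pieces, written as inline `Set.indicator` lambdas: `𝟙_{K_{ℓ₀,m*}}`, `𝟙_{K_{ℓ₀+1,m*}}` (the two
halves of the near-transvection shell) and `𝟙{u ∈ K ∣ X² ∈ ϖ^{m*}M₃}` (the complement of `f_reg` in `1_K`), `ℓ₀ = dOfPlace % 2`, `m* = mstarFn`.  Every such row is paid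
like the anchor row (`stub_rows_unit0`, the E3 twin ★ `pieceRowsWild_gselStar_zero_of`): a (D-G) census dictionary + census laws + an H-side realisation + a joint.  THIS FILE
IS THE (D-G) LAYER FOR THOSE PIECES, for ARBITRARY level schedules `a, b : (L, v, w) ↦ ℕ` — one `exact` each of the generic profile dictionary ★ `pieceCountDictionary_of_profile`
(B-p08 (g41)) — in the unit-U2G export currency ★ `PieceCountDictionary g cnt`:
`Φ(⟦γ⟧, 𝟙_{K_{a,b}}; mG₃) = νG₃(K).toReal · #{type-0 vertices M : ι_wγ·M = M, (ι_wγ − 1)M ⊆ ϖ^a M, (ι_wγ − 1)²M ⊆ ϖ^b M}` at every type-(1) literal `γ` of every wild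
ramified non-split place, and the same with the single square-level condition.  §3 adds the CENSUS-CURRENCY BRIDGE at a literal `T` whose fixed type-0 vertex set is finite
(finite-cardinality algebra over ★ p854672's counts): `#shell_{ℓ,m} + #levels_{ℓ+1,m} = #levels_{ℓ,m}` — together with LH4-p12 (g7)'s two bridges
`ncard_sqLevel_add_regFixCount_eq_fixedVertexCount` (`#sqLevel_m + regFixCount = fixedVertexCount σ ϖ 0`) and `transvPlusFixCount_add_transvMinusFixCount`
(`transvPlusFixCount + transvMinusFixCount = #shell_{ℓ,m}`) of `Theorems/F0P3cDyRamFrameEltLevelAlgebra.lean` (not restated here — board: one hand per statement), every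
G-side census of the reduction reads in ONE currency `#levels_{a,b}` (plus the `T₊` label census), and the square-level count is `n₀ − regFixCount`.

* §1 `levels_profile_conj_iff`, `sqLevel_profile_conj_iff` (transport `𝒪³ ↝ g·𝒪³`), `inLevel_mul_self_units_conj_iff`, `latticeInLevel_of_succ`;
  `indicator_levels_conj_eq`, `indicator_sqLevel_conj_eq` (`Ad K`), `isLocSmooth_indicator_levels`, `isLocSmooth_indicator_sqLevel` (`C_c^∞`, `tsupport ⊆ K`; hypothesis-free
  in `a, b` — the level used is `a + b + 1` ∕ `b + 1`).
* §2 `pieceCountDictionary_levels (a b)`, `pieceCountDictionary_sqLevel (b)`; instances of record `pieceCountDictionary_levels_shellLow` (`(ℓ₀, m*)`),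
  `pieceCountDictionary_levels_shellHigh` (`(ℓ₀ + 1, m*)`), `pieceCountDictionary_sqLevel_mstar` (`m*`) — the pieces are F0P3a-p01 (g35)'s §5 lambdas token for token.
* §3 `ncard_shell_add_ncard_levels_succ_eq_ncard_levels` (the two other bridges are LH4-p12 (g7)'s, `Theorems/F0P3cDyRamFrameEltLevelAlgebra.lean`).
HONEST LABEL.  Count-neutral (`--supports`): no tier-0 row is paid here; `HC_CM` is proved only modulo the 7 printed citations (2 remaining named inputs: hLiu418 =
`stmt-HodgeConjecture-24832`, h413 = `stmt-HodgeConjecture-24833`) until rung 0 closes.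

## References
* [Kottwitz1986BaseChangeUnits] R. E. Kottwitz, *Base change for unit elements of Hecke algebras*, Compositio Math. 60 (1986), §1 pp. 240–241, §3.
* [Rogawski1990] J. D. Rogawski, *Automorphic Representations of Unitary Groups in Three Variables*, Ann. of Math. Stud. 123 (1990), §4.9 Prop. 4.9.1 (b) p. 55.
* [Laumon1995] G. Laumon, *Cohomology of Drinfeld Modular Varieties I* (1996), Lemma (5.3.2) p. 136.
-/

set_option autoImplicit false

noncomputable section

namespace Summit.HodgeConjecture.HodgeConjecture.Cruxes.H413.F0P3cDyRamLevelsPieceCountDictionary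

open MeasureTheory Measure NumberField IsDedekindDomain Topology Filter
open Literature.NumberTheory.Automorphic Literature.NumberTheory.Automorphic.UnitaryGroup Literature.NumberTheory.Automorphic.IntegralReduction
open Literature.NumberTheory.Automorphic.UnitaryLatticeTree Literature.NumberTheory.Automorphic.HermitianLattice
open Literature.NumberTheory.Rogawski1990 Literature.NumberTheory.GaloisRepresentations
open Literature.MeasureTheory.Group (descConj)
open Literature.NumberTheory.Automorphic.UnitaryThreeFourFrame
open Summit.HodgeConjecture.HodgeConjecture.Cruxes.H413.F0P3cDyRamFourFramePieces
open Summit.HodgeConjecture.HodgeConjecture.Cruxes.H413.F0P3cDyRamFourFrameCensusDefs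
open Summit.HodgeConjecture.HodgeConjecture.Cruxes.H413.F0P3cDyRamProfileLabelTransport
open Summit.HodgeConjecture.HodgeConjecture.Cruxes.H413.F0P3cDyRamProfileLevelClass
open Summit.HodgeConjecture.HodgeConjecture.Cruxes.H413.F0P3cDyRamProfilePiecesProps
open Summit.HodgeConjecture.HodgeConjecture.Cruxes.H413.F0P3cDyRamPieceCountDictionaryProfiles
open scoped Matrix MatrixGroups Classical WithZero

/-! ## §1  Transport, `Ad K`-invariance and smoothness of the two congruence-profile shapes -/

section Transport

variable {K : Type*} [Field K] [Valued K ℤᵐ⁰]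

/-- **LEVELS TRANSPORT**: for `T ∈ GL₃(K)` and any `g`, the two-level profile of `g⁻¹Tg − 1` on `𝒪³` iff the vertex-side profile of `T − 1` at `g·𝒪³`:
`(g⁻¹Tg − 1 ∈ ϖ^a M₃ ∧ (g⁻¹Tg − 1)² ∈ ϖ^b M₃) ↔ ((T − 1)·g𝒪³ ⊆ ϖ^a·g𝒪³ ∧ (T − 1)²·g𝒪³ ⊆ ϖ^b·g𝒪³)` (★ p854719 `inLevel_conj_iff_latticeInLevel`, `reg_profile_conj_iff`).
[cite: Kottwitz1986BaseChangeUnits, §3] -/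
theorem levels_profile_conj_iff {ϖ : K} (hϖ : ϖ ≠ 0) (a b : ℕ) (T : Matrix (Fin 3) (Fin 3) K) (g : GL (Fin 3) K) :
    (InLevel ϖ a ((g : Matrix (Fin 3) (Fin 3) K)⁻¹ * T * (g : Matrix (Fin 3) (Fin 3) K) - 1) ∧
        InLevel ϖ b (((g : Matrix (Fin 3) (Fin 3) K)⁻¹ * T * (g : Matrix (Fin 3) (Fin 3) K) - 1) *
          ((g : Matrix (Fin 3) (Fin 3) K)⁻¹ * T * (g : Matrix (Fin 3) (Fin 3) K) - 1))) ↔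
      (LatticeInLevel ϖ a (T - 1) (mapGL g (stdLattice K 3)) ∧ LatticeInLevel ϖ b ((T - 1) * (T - 1)) (mapGL g (stdLattice K 3))) :=
  and_congr (by rw [conj_sub_one, inLevel_conj_iff_latticeInLevel hϖ]) (not_iff_not.1 (reg_profile_conj_iff hϖ b T g))

/-- **SQUARE-LEVEL TRANSPORT**: `(g⁻¹Tg − 1)² ∈ ϖ^b M₃(𝒪) ↔ (T − 1)²·g𝒪³ ⊆ ϖ^b·g𝒪³` (the positive form of ★ p854719 `reg_profile_conj_iff`).
[cite: Kottwitz1986BaseChangeUnits, §3] -/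
theorem sqLevel_profile_conj_iff {ϖ : K} (hϖ : ϖ ≠ 0) (b : ℕ) (T : Matrix (Fin 3) (Fin 3) K) (g : GL (Fin 3) K) :
    InLevel ϖ b (((g : Matrix (Fin 3) (Fin 3) K)⁻¹ * T * (g : Matrix (Fin 3) (Fin 3) K) - 1) *
        ((g : Matrix (Fin 3) (Fin 3) K)⁻¹ * T * (g : Matrix (Fin 3) (Fin 3) K) - 1)) ↔
      LatticeInLevel ϖ b ((T - 1) * (T - 1)) (mapGL g (stdLattice K 3)) :=
  not_iff_not.1 (reg_profile_conj_iff hϖ b T g)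

/-- `(k⁻¹Xk)² ∈ ϖ^b M₃(𝒪) ↔ X² ∈ ϖ^b M₃(𝒪)` for `k` with `k·𝒪³ = 𝒪³` (★ `conj_mul_conj` + ★ p854732 `inLevel_units_conj_iff`). [cite: Kottwitz1986BaseChangeUnits, §1 pp. 240–241] -/
theorem inLevel_mul_self_units_conj_iff {ϖ : K} (hϖ : ϖ ≠ 0) (b : ℕ) (X : Matrix (Fin 3) (Fin 3) K) {k : GL (Fin 3) K}
    (hk : mapGL k (stdLattice K 3) = stdLattice K 3) :
    InLevel ϖ b ((k : Matrix (Fin 3) (Fin 3) K)⁻¹ * X * (k : Matrix (Fin 3) (Fin 3) K) * ((k : Matrix (Fin 3) (Fin 3) K)⁻¹ * X * (k : Matrix (Fin 3) (Fin 3) K))) ↔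
      InLevel ϖ b (X * X) := by
  have hsq : (k : Matrix (Fin 3) (Fin 3) K)⁻¹ * X * (k : Matrix (Fin 3) (Fin 3) K) * ((k : Matrix (Fin 3) (Fin 3) K)⁻¹ * X * (k : Matrix (Fin 3) (Fin 3) K)) =
      (k : Matrix (Fin 3) (Fin 3) K)⁻¹ * (X * X) * (k : Matrix (Fin 3) (Fin 3) K) := by
    rw [Matrix.mul_assoc ((k : Matrix (Fin 3) (Fin 3) K)⁻¹) X (k : Matrix (Fin 3) (Fin 3) K), conj_mul_conj k X X]
    simp only [Matrix.mul_assoc]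
  rw [hsq, inLevel_units_conj_iff hϖ _ _ hk]

/-- Antitonicity in the level on the vertex side: `X·M ⊆ ϖ^{ℓ+1}M ⇒ X·M ⊆ ϖ^ℓ M` (`|ϖ| ≤ 1`, ★ `scaleLattice_pow_antitone`). [cite: Kottwitz1986BaseChangeUnits, §1 pp. 240–241] -/
theorem latticeInLevel_of_succ {ϖ : K} (hϖ1 : Valued.v ϖ ≤ 1) {ℓ : ℕ} {X : Matrix (Fin 3) (Fin 3) K} {M : Submodule (Valued.integer K) (Fin 3 → K)}
    (h : LatticeInLevel ϖ (ℓ + 1) X M) : LatticeInLevel ϖ ℓ X M :=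
  h.trans (scaleLattice_pow_antitone hϖ1 M (Nat.le_succ ℓ))

end Transport

section Pieces

variable (L : Type) [Field L] [NumberField L] [IsCMField L] {v : HeightOneSpectrum (𝓞 ↥(maximalRealSubfield L))}
  (w : UnitaryGroup.PlacesOver L v) (hw : IsCMField.complexConj L • w.1 = w.1)

include hw in
/-- **`𝟙_{K_{a,b}}` IS `Ad K`-INVARIANT** (★ p854742 `indicator_profile_conj_eq`: both conditions are stable under `k ∈ GL₃(𝒪)`-conjugation). [cite: Kottwitz1986BaseChangeUnits, §3]
[cite: Rogawski1990, §4.9 p. 54] -/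
theorem indicator_levels_conj_eq {ϖ : w.1.adicCompletion L} (hϖ : Valued.v ϖ = WithZero.exp (-1 : ℤ)) (a b : ℕ)
    {k : ((UnitaryGroup.cmDatum L 3 (Matrix.of fun i j : Fin 3 => if i.val + j.val + 1 = 3 then (1 : L) else 0)).Local v)}
    (hk : k ∈ cmLocalIntegralLevel L 3 (Matrix.of fun i j : Fin 3 => if i.val + j.val + 1 = 3 then (1 : L) else 0) v)
    (x : ((UnitaryGroup.cmDatum L 3 (Matrix.of fun i j : Fin 3 => if i.val + j.val + 1 = 3 then (1 : L) else 0)).Local v)) :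
    Set.indicator {u : ((UnitaryGroup.cmDatum L 3 (Matrix.of fun i j : Fin 3 => if i.val + j.val + 1 = 3 then (1 : L) else 0)).Local v) |
          u ∈ cmLocalIntegralLevel L 3 (Matrix.of fun i j : Fin 3 => if i.val + j.val + 1 = 3 then (1 : L) else 0) v ∧
          (InLevel ϖ a (wMatrix L w hw u - 1) ∧ InLevel ϖ b ((wMatrix L w hw u - 1) * (wMatrix L w hw u - 1)))} (fun _ => (1 : ℂ)) (k * x * k⁻¹) =
      Set.indicator {u : ((UnitaryGroup.cmDatum L 3 (Matrix.of fun i j : Fin 3 => if i.val + j.val + 1 = 3 then (1 : L) else 0)).Local v) |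
          u ∈ cmLocalIntegralLevel L 3 (Matrix.of fun i j : Fin 3 => if i.val + j.val + 1 = 3 then (1 : L) else 0) v ∧
          (InLevel ϖ a (wMatrix L w hw u - 1) ∧ InLevel ϖ b ((wMatrix L w hw u - 1) * (wMatrix L w hw u - 1)))} (fun _ => (1 : ℂ)) x := by
  obtain ⟨hϖ0, -, -⟩ := uniformizer_facts L w hϖ
  simp only [wMatrix]
  exact indicator_profile_conj_eq L w hw (fun X => InLevel ϖ a X ∧ InLevel ϖ b (X * X))
    (fun g _ hgL X => and_congr (inLevel_units_conj_iff hϖ0 _ X hgL) (inLevel_mul_self_units_conj_iff hϖ0 _ X hgL)) hk x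

include hw in
/-- **`𝟙{u ∈ K ∣ X² ∈ ϖ^b M₃}` IS `Ad K`-INVARIANT**. [cite: Kottwitz1986BaseChangeUnits, §3] [cite: Rogawski1990, §4.9 p. 54] -/
theorem indicator_sqLevel_conj_eq {ϖ : w.1.adicCompletion L} (hϖ : Valued.v ϖ = WithZero.exp (-1 : ℤ)) (b : ℕ)
    {k : ((UnitaryGroup.cmDatum L 3 (Matrix.of fun i j : Fin 3 => if i.val + j.val + 1 = 3 then (1 : L) else 0)).Local v)}
    (hk : k ∈ cmLocalIntegralLevel L 3 (Matrix.of fun i j : Fin 3 => if i.val + j.val + 1 = 3 then (1 : L) else 0) v)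
    (x : ((UnitaryGroup.cmDatum L 3 (Matrix.of fun i j : Fin 3 => if i.val + j.val + 1 = 3 then (1 : L) else 0)).Local v)) :
    Set.indicator {u : ((UnitaryGroup.cmDatum L 3 (Matrix.of fun i j : Fin 3 => if i.val + j.val + 1 = 3 then (1 : L) else 0)).Local v) |
          u ∈ cmLocalIntegralLevel L 3 (Matrix.of fun i j : Fin 3 => if i.val + j.val + 1 = 3 then (1 : L) else 0) v ∧
          InLevel ϖ b ((wMatrix L w hw u - 1) * (wMatrix L w hw u - 1))} (fun _ => (1 : ℂ)) (k * x * k⁻¹) =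
      Set.indicator {u : ((UnitaryGroup.cmDatum L 3 (Matrix.of fun i j : Fin 3 => if i.val + j.val + 1 = 3 then (1 : L) else 0)).Local v) |
          u ∈ cmLocalIntegralLevel L 3 (Matrix.of fun i j : Fin 3 => if i.val + j.val + 1 = 3 then (1 : L) else 0) v ∧
          InLevel ϖ b ((wMatrix L w hw u - 1) * (wMatrix L w hw u - 1))} (fun _ => (1 : ℂ)) x := by
  obtain ⟨hϖ0, -, -⟩ := uniformizer_facts L w hϖ
  simp only [wMatrix]
  exact indicator_profile_conj_eq L w hw (fun X => InLevel ϖ b (X * X))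
    (fun g _ hgL X => inLevel_mul_self_units_conj_iff hϖ0 _ X hgL) hk x

include hw in
/-- **`𝟙_{K_{a,b}}` IS `C_c^∞` WITH `tsupport ⊆ K`** for EVERY `a, b` (a level class function at level `a + b + 1 ≥ 1`: ★ p854742 `isLocSmooth_indicator_profile` with ★ p854732
`inLevel_add_iff_of_inLevel` + `inLevel_mul_self_add_iff`; F0P3a-p01 (g35)'s `isLocSmooth_levelsPiece` is the same statement under `a, b ≤ m* + 2`).
[cite: BernsteinZelevinsky1976, §1.1] [cite: Kottwitz1986BaseChangeUnits, §1 pp. 240–241] -/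
theorem isLocSmooth_indicator_levels {ϖ : w.1.adicCompletion L} (hϖ : Valued.v ϖ = WithZero.exp (-1 : ℤ)) (a b : ℕ) :
    IsLocSmooth (Set.indicator {u : ((UnitaryGroup.cmDatum L 3 (Matrix.of fun i j : Fin 3 => if i.val + j.val + 1 = 3 then (1 : L) else 0)).Local v) |
          u ∈ cmLocalIntegralLevel L 3 (Matrix.of fun i j : Fin 3 => if i.val + j.val + 1 = 3 then (1 : L) else 0) v ∧
          (InLevel ϖ a (wMatrix L w hw u - 1) ∧ InLevel ϖ b ((wMatrix L w hw u - 1) * (wMatrix L w hw u - 1)))} (fun _ => (1 : ℂ))) ∧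
      tsupport (Set.indicator {u : ((UnitaryGroup.cmDatum L 3 (Matrix.of fun i j : Fin 3 => if i.val + j.val + 1 = 3 then (1 : L) else 0)).Local v) |
          u ∈ cmLocalIntegralLevel L 3 (Matrix.of fun i j : Fin 3 => if i.val + j.val + 1 = 3 then (1 : L) else 0) v ∧
          (InLevel ϖ a (wMatrix L w hw u - 1) ∧ InLevel ϖ b ((wMatrix L w hw u - 1) * (wMatrix L w hw u - 1)))} (fun _ => (1 : ℂ))) ⊆
        (cmLocalIntegralLevel L 3 (Matrix.of fun i j : Fin 3 => if i.val + j.val + 1 = 3 then (1 : L) else 0) v :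
          Set ((UnitaryGroup.cmDatum L 3 (Matrix.of fun i j : Fin 3 => if i.val + j.val + 1 = 3 then (1 : L) else 0)).Local v)) := by
  obtain ⟨hϖ0, hϖ1, hϖ1'⟩ := uniformizer_facts L w hϖ
  simp only [wMatrix]
  exact isLocSmooth_indicator_profile L w hw (fun X => InLevel ϖ a X ∧ InLevel ϖ b (X * X)) hϖ0 hϖ1 (show 1 ≤ a + b + 1 by omega)
    (fun X D hX hD => and_congr (inLevel_add_iff_of_inLevel hϖ0 hϖ1' (show a ≤ a + b + 1 by omega) hD)
      (inLevel_mul_self_add_iff hϖ0 hϖ1' (show b ≤ a + b + 1 by omega) hX hD))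

include hw in
/-- **`𝟙{u ∈ K ∣ X² ∈ ϖ^b M₃}` IS `C_c^∞` WITH `tsupport ⊆ K`** for every `b` (level `b + 1`). [cite: BernsteinZelevinsky1976, §1.1] [cite: Kottwitz1986BaseChangeUnits, §1 pp. 240–241] -/
theorem isLocSmooth_indicator_sqLevel {ϖ : w.1.adicCompletion L} (hϖ : Valued.v ϖ = WithZero.exp (-1 : ℤ)) (b : ℕ) :
    IsLocSmooth (Set.indicator {u : ((UnitaryGroup.cmDatum L 3 (Matrix.of fun i j : Fin 3 => if i.val + j.val + 1 = 3 then (1 : L) else 0)).Local v) |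
          u ∈ cmLocalIntegralLevel L 3 (Matrix.of fun i j : Fin 3 => if i.val + j.val + 1 = 3 then (1 : L) else 0) v ∧
          InLevel ϖ b ((wMatrix L w hw u - 1) * (wMatrix L w hw u - 1))} (fun _ => (1 : ℂ))) ∧
      tsupport (Set.indicator {u : ((UnitaryGroup.cmDatum L 3 (Matrix.of fun i j : Fin 3 => if i.val + j.val + 1 = 3 then (1 : L) else 0)).Local v) |
          u ∈ cmLocalIntegralLevel L 3 (Matrix.of fun i j : Fin 3 => if i.val + j.val + 1 = 3 then (1 : L) else 0) v ∧
          InLevel ϖ b ((wMatrix L w hw u - 1) * (wMatrix L w hw u - 1))} (fun _ => (1 : ℂ))) ⊆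
        (cmLocalIntegralLevel L 3 (Matrix.of fun i j : Fin 3 => if i.val + j.val + 1 = 3 then (1 : L) else 0) v :
          Set ((UnitaryGroup.cmDatum L 3 (Matrix.of fun i j : Fin 3 => if i.val + j.val + 1 = 3 then (1 : L) else 0)).Local v)) := by
  obtain ⟨hϖ0, hϖ1, hϖ1'⟩ := uniformizer_facts L w hϖ
  simp only [wMatrix]
  exact isLocSmooth_indicator_profile L w hw (fun X => InLevel ϖ b (X * X)) hϖ0 hϖ1 (show 1 ≤ b + 1 by omega)
    (fun X D hX hD => inLevel_mul_self_add_iff hϖ0 hϖ1' (Nat.le_succ b) hX hD)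

end Pieces

/-! ## §2  The (D-G) dictionaries `PieceCountDictionary 𝟙_{K_{a,b}} cnt_{a,b}` and `PieceCountDictionary 𝟙_{K ∩ {X² ∈ ϖ^b}} cnt_b` -/

/-- **THE (D-G) DICTIONARY OF `𝟙_{K_{a,b}}` FOR ARBITRARY LEVEL SCHEDULES `a, b`**: at every wild ramified non-split place and every type-(1) literal `γ` (place matrix
`z·Γ_b`), `Φ(⟦γ⟧, 𝟙_{K_{a,b}}; mG₃) = νG₃(K).toReal · #{type-0 vertices M : ι_wγ·M = M ∧ (ι_wγ − 1)·M ⊆ ϖ^{a}M ∧ (ι_wγ − 1)²·M ⊆ ϖ^{b}M}` — ONE `exact` of ★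
`pieceCountDictionary_of_profile` at the profile `X ↦ (X ∈ ϖ^a M₃ ∧ X² ∈ ϖ^b M₃)` and its vertex-side reading (§1).
[cite: Kottwitz1986BaseChangeUnits, §1 pp. 240–241, §3] [cite: Rogawski1990, §4.9 Prop. 4.9.1 (b) p. 55] [cite: Laumon1995, Lemma (5.3.2) p. 136] -/
theorem pieceCountDictionary_levels
    (a b : ∀ (L : Type) [Field L] [NumberField L] [IsCMField L] (v : HeightOneSpectrum (𝓞 ↥(maximalRealSubfield L))), UnitaryGroup.PlacesOver L v → ℕ) :
    PieceCountDictionary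
      (fun (L : Type) [Field L] [NumberField L] [IsCMField L] (v : HeightOneSpectrum (𝓞 ↥(maximalRealSubfield L))) (w : UnitaryGroup.PlacesOver L v)
          (hw : IsCMField.complexConj L • w.1 = w.1) (ϖ : w.1.adicCompletion L) =>
        Set.indicator {u : ((UnitaryGroup.cmDatum L 3 (Matrix.of fun i j : Fin 3 => if i.val + j.val + 1 = 3 then (1 : L) else 0)).Local v) |
            u ∈ cmLocalIntegralLevel L 3 (Matrix.of fun i j : Fin 3 => if i.val + j.val + 1 = 3 then (1 : L) else 0) v ∧
            (InLevel ϖ (a L v w) (wMatrix L w hw u - 1) ∧ InLevel ϖ (b L v w) ((wMatrix L w hw u - 1) * (wMatrix L w hw u - 1)))} (fun _ => (1 : ℂ)))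
      (fun (L : Type) [Field L] [NumberField L] [IsCMField L] (v : HeightOneSpectrum (𝓞 ↥(maximalRealSubfield L))) (w : UnitaryGroup.PlacesOver L v)
          (hw : IsCMField.complexConj L • w.1 = w.1) (ϖ : w.1.adicCompletion L) (T : GL (Fin 3) (w.1.adicCompletion L)) =>
        {M : Submodule (Valued.integer (w.1.adicCompletion L)) (Fin 3 → w.1.adicCompletion L) |
            IsVertexLattice (galAdicCompletionMap (L := L) (IsCMField.complexConj L) hw) ϖ ((StdForm.antidiagonal 3).over (w.1.adicCompletion L)) 0 M ∧ mapGL T M = M ∧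
              (LatticeInLevel ϖ (a L v w) ((T : Matrix (Fin 3) (Fin 3) (w.1.adicCompletion L)) - 1) M ∧
                LatticeInLevel ϖ (b L v w) (((T : Matrix (Fin 3) (Fin 3) (w.1.adicCompletion L)) - 1) * ((T : Matrix (Fin 3) (Fin 3) (w.1.adicCompletion L)) - 1)) M)}.ncard) :=
  pieceCountDictionary_of_profile
    (fun L _ _ _ v w _ ϖ X => InLevel ϖ (a L v w) X ∧ InLevel ϖ (b L v w) (X * X))
    (fun L _ _ _ v w _ ϖ X M => LatticeInLevel ϖ (a L v w) X M ∧ LatticeInLevel ϖ (b L v w) (X * X) M)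
    _ _ (fun _ _ _ _ _ _ _ _ => rfl) (fun _ _ _ _ _ _ _ _ _ => rfl)
    (fun L _ _ _ v w hw _ hϖ => isLocSmooth_indicator_levels L w hw hϖ (a L v w) (b L v w))
    (fun L _ _ _ v w hw _ hϖ _ hk x => indicator_levels_conj_eq L w hw hϖ (a L v w) (b L v w) hk x)
    (fun L _ _ _ v w _ _ hϖ0 T x _ => levels_profile_conj_iff hϖ0 (a L v w) (b L v w) T x)

/-- **THE (D-G) DICTIONARY OF THE SQUARE-LEVEL PIECE `𝟙{u ∈ K ∣ X² ∈ ϖ^b M₃}` FOR AN ARBITRARY LEVEL SCHEDULE `b`**: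
`Φ(⟦γ⟧, 𝟙{u ∈ K ∣ X² ∈ ϖ^b M₃}; mG₃) = νG₃(K).toReal · #{type-0 vertices M : ι_wγ·M = M ∧ (ι_wγ − 1)²·M ⊆ ϖ^{b}M}`.
[cite: Kottwitz1986BaseChangeUnits, §1 pp. 240–241, §3] [cite: Rogawski1990, §4.9 Prop. 4.9.1 (b) p. 55] [cite: Laumon1995, Lemma (5.3.2) p. 136] -/
theorem pieceCountDictionary_sqLevel
    (b : ∀ (L : Type) [Field L] [NumberField L] [IsCMField L] (v : HeightOneSpectrum (𝓞 ↥(maximalRealSubfield L))), UnitaryGroup.PlacesOver L v → ℕ) :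
    PieceCountDictionary
      (fun (L : Type) [Field L] [NumberField L] [IsCMField L] (v : HeightOneSpectrum (𝓞 ↥(maximalRealSubfield L))) (w : UnitaryGroup.PlacesOver L v)
          (hw : IsCMField.complexConj L • w.1 = w.1) (ϖ : w.1.adicCompletion L) =>
        Set.indicator {u : ((UnitaryGroup.cmDatum L 3 (Matrix.of fun i j : Fin 3 => if i.val + j.val + 1 = 3 then (1 : L) else 0)).Local v) |
            u ∈ cmLocalIntegralLevel L 3 (Matrix.of fun i j : Fin 3 => if i.val + j.val + 1 = 3 then (1 : L) else 0) v ∧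
            InLevel ϖ (b L v w) ((wMatrix L w hw u - 1) * (wMatrix L w hw u - 1))} (fun _ => (1 : ℂ)))
      (fun (L : Type) [Field L] [NumberField L] [IsCMField L] (v : HeightOneSpectrum (𝓞 ↥(maximalRealSubfield L))) (w : UnitaryGroup.PlacesOver L v)
          (hw : IsCMField.complexConj L • w.1 = w.1) (ϖ : w.1.adicCompletion L) (T : GL (Fin 3) (w.1.adicCompletion L)) =>
        {M : Submodule (Valued.integer (w.1.adicCompletion L)) (Fin 3 → w.1.adicCompletion L) |
            IsVertexLattice (galAdicCompletionMap (L := L) (IsCMField.complexConj L) hw) ϖ ((StdForm.antidiagonal 3).over (w.1.adicCompletion L)) 0 M ∧ mapGL T M = M ∧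
              LatticeInLevel ϖ (b L v w) (((T : Matrix (Fin 3) (Fin 3) (w.1.adicCompletion L)) - 1) * ((T : Matrix (Fin 3) (Fin 3) (w.1.adicCompletion L)) - 1)) M}.ncard) :=
  pieceCountDictionary_of_profile
    (fun L _ _ _ v w _ ϖ X => InLevel ϖ (b L v w) (X * X))
    (fun L _ _ _ v w _ ϖ X M => LatticeInLevel ϖ (b L v w) (X * X) M)
    _ _ (fun _ _ _ _ _ _ _ _ => rfl) (fun _ _ _ _ _ _ _ _ _ => rfl)
    (fun L _ _ _ v w hw _ hϖ => isLocSmooth_indicator_sqLevel L w hw hϖ (b L v w))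
    (fun L _ _ _ v w hw _ hϖ _ hk x => indicator_sqLevel_conj_eq L w hw hϖ (b L v w) hk x)
    (fun L _ _ _ v w _ _ hϖ0 T x _ => sqLevel_profile_conj_iff hϖ0 (b L v w) T x)

/-- **INSTANCE OF RECORD `(a, b) = (ℓ₀, m*)`** (`ℓ₀ = dOfPlace % 2`, `m* = mstarFn`): the (D-G) dictionary of the LOWER SHELL HALF `𝟙_{K_{ℓ₀,m*}}` — the piece of F0P3a-p01 (g35)'s
`pieceRowsWild_shell_of_levels`, hypothesis `hA`, token for token. [cite: Kottwitz1986BaseChangeUnits, §1 pp. 240–241, §3] [cite: Rogawski1990, §4.9 Prop. 4.9.1 (b) p. 55] -/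
theorem pieceCountDictionary_levels_shellLow :
    PieceCountDictionary
      (fun (L : Type) [Field L] [NumberField L] [IsCMField L] (v : HeightOneSpectrum (𝓞 ↥(maximalRealSubfield L))) (w : UnitaryGroup.PlacesOver L v)
          (hw : IsCMField.complexConj L • w.1 = w.1) (ϖ : w.1.adicCompletion L) =>
        Set.indicator {u : ((UnitaryGroup.cmDatum L 3 (Matrix.of fun i j : Fin 3 => if i.val + j.val + 1 = 3 then (1 : L) else 0)).Local v) |
            u ∈ cmLocalIntegralLevel L 3 (Matrix.of fun i j : Fin 3 => if i.val + j.val + 1 = 3 then (1 : L) else 0) v ∧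
            (InLevel ϖ (dOfPlace L v w % 2) (wMatrix L w hw u - 1) ∧ InLevel ϖ (mstarFn L v w) ((wMatrix L w hw u - 1) * (wMatrix L w hw u - 1)))} (fun _ => (1 : ℂ)))
      (fun (L : Type) [Field L] [NumberField L] [IsCMField L] (v : HeightOneSpectrum (𝓞 ↥(maximalRealSubfield L))) (w : UnitaryGroup.PlacesOver L v)
          (hw : IsCMField.complexConj L • w.1 = w.1) (ϖ : w.1.adicCompletion L) (T : GL (Fin 3) (w.1.adicCompletion L)) =>
        {M : Submodule (Valued.integer (w.1.adicCompletion L)) (Fin 3 → w.1.adicCompletion L) |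
            IsVertexLattice (galAdicCompletionMap (L := L) (IsCMField.complexConj L) hw) ϖ ((StdForm.antidiagonal 3).over (w.1.adicCompletion L)) 0 M ∧ mapGL T M = M ∧
              (LatticeInLevel ϖ (dOfPlace L v w % 2) ((T : Matrix (Fin 3) (Fin 3) (w.1.adicCompletion L)) - 1) M ∧
                LatticeInLevel ϖ (mstarFn L v w) (((T : Matrix (Fin 3) (Fin 3) (w.1.adicCompletion L)) - 1) * ((T : Matrix (Fin 3) (Fin 3) (w.1.adicCompletion L)) - 1)) M)}.ncard) :=
  pieceCountDictionary_levels (fun L _ _ _ v w => dOfPlace L v w % 2) mstarFn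

/-- **INSTANCE OF RECORD `(a, b) = (ℓ₀ + 1, m*)`**: the (D-G) dictionary of the UPPER SHELL HALF `𝟙_{K_{ℓ₀+1,m*}}` — F0P3a-p01 (g35)'s `pieceRowsWild_shell_of_levels`, hypothesis
`hB`, token for token. [cite: Kottwitz1986BaseChangeUnits, §1 pp. 240–241, §3] [cite: Rogawski1990, §4.9 Prop. 4.9.1 (b) p. 55] -/
theorem pieceCountDictionary_levels_shellHigh :
    PieceCountDictionary
      (fun (L : Type) [Field L] [NumberField L] [IsCMField L] (v : HeightOneSpectrum (𝓞 ↥(maximalRealSubfield L))) (w : UnitaryGroup.PlacesOver L v)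
          (hw : IsCMField.complexConj L • w.1 = w.1) (ϖ : w.1.adicCompletion L) =>
        Set.indicator {u : ((UnitaryGroup.cmDatum L 3 (Matrix.of fun i j : Fin 3 => if i.val + j.val + 1 = 3 then (1 : L) else 0)).Local v) |
            u ∈ cmLocalIntegralLevel L 3 (Matrix.of fun i j : Fin 3 => if i.val + j.val + 1 = 3 then (1 : L) else 0) v ∧
            (InLevel ϖ (dOfPlace L v w % 2 + 1) (wMatrix L w hw u - 1) ∧ InLevel ϖ (mstarFn L v w) ((wMatrix L w hw u - 1) * (wMatrix L w hw u - 1)))} (fun _ => (1 : ℂ)))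
      (fun (L : Type) [Field L] [NumberField L] [IsCMField L] (v : HeightOneSpectrum (𝓞 ↥(maximalRealSubfield L))) (w : UnitaryGroup.PlacesOver L v)
          (hw : IsCMField.complexConj L • w.1 = w.1) (ϖ : w.1.adicCompletion L) (T : GL (Fin 3) (w.1.adicCompletion L)) =>
        {M : Submodule (Valued.integer (w.1.adicCompletion L)) (Fin 3 → w.1.adicCompletion L) |
            IsVertexLattice (galAdicCompletionMap (L := L) (IsCMField.complexConj L) hw) ϖ ((StdForm.antidiagonal 3).over (w.1.adicCompletion L)) 0 M ∧ mapGL T M = M ∧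
              (LatticeInLevel ϖ (dOfPlace L v w % 2 + 1) ((T : Matrix (Fin 3) (Fin 3) (w.1.adicCompletion L)) - 1) M ∧
                LatticeInLevel ϖ (mstarFn L v w) (((T : Matrix (Fin 3) (Fin 3) (w.1.adicCompletion L)) - 1) * ((T : Matrix (Fin 3) (Fin 3) (w.1.adicCompletion L)) - 1)) M)}.ncard) :=
  pieceCountDictionary_levels (fun L _ _ _ v w => dOfPlace L v w % 2 + 1) mstarFn

/-- **INSTANCE OF RECORD `b = m*`**: the (D-G) dictionary of the SQUARE-LEVEL PIECE `𝟙{u ∈ K ∣ X² ∈ ϖ^{m*}M₃}` — F0P3a-p01 (g35)'s `pieceRowsWild_gselStar_three_of`, hypothesis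
`hSq`, token for token; its count is `n₀ − regFixCount` on a finite fixed set (§3). [cite: Kottwitz1986BaseChangeUnits, §1 pp. 240–241, §3] [cite: Rogawski1990, §4.9 Prop. 4.9.1 (b) p. 55] -/
theorem pieceCountDictionary_sqLevel_mstar :
    PieceCountDictionary
      (fun (L : Type) [Field L] [NumberField L] [IsCMField L] (v : HeightOneSpectrum (𝓞 ↥(maximalRealSubfield L))) (w : UnitaryGroup.PlacesOver L v)
          (hw : IsCMField.complexConj L • w.1 = w.1) (ϖ : w.1.adicCompletion L) =>
        Set.indicator {u : ((UnitaryGroup.cmDatum L 3 (Matrix.of fun i j : Fin 3 => if i.val + j.val + 1 = 3 then (1 : L) else 0)).Local v) |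
            u ∈ cmLocalIntegralLevel L 3 (Matrix.of fun i j : Fin 3 => if i.val + j.val + 1 = 3 then (1 : L) else 0) v ∧
            InLevel ϖ (mstarFn L v w) ((wMatrix L w hw u - 1) * (wMatrix L w hw u - 1))} (fun _ => (1 : ℂ)))
      (fun (L : Type) [Field L] [NumberField L] [IsCMField L] (v : HeightOneSpectrum (𝓞 ↥(maximalRealSubfield L))) (w : UnitaryGroup.PlacesOver L v)
          (hw : IsCMField.complexConj L • w.1 = w.1) (ϖ : w.1.adicCompletion L) (T : GL (Fin 3) (w.1.adicCompletion L)) =>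
        {M : Submodule (Valued.integer (w.1.adicCompletion L)) (Fin 3 → w.1.adicCompletion L) |
            IsVertexLattice (galAdicCompletionMap (L := L) (IsCMField.complexConj L) hw) ϖ ((StdForm.antidiagonal 3).over (w.1.adicCompletion L)) 0 M ∧ mapGL T M = M ∧
              LatticeInLevel ϖ (mstarFn L v w) (((T : Matrix (Fin 3) (Fin 3) (w.1.adicCompletion L)) - 1) * ((T : Matrix (Fin 3) (Fin 3) (w.1.adicCompletion L)) - 1)) M}.ncard) :=
  pieceCountDictionary_sqLevel mstarFn

/-! ## §3  The census-currency bridge `shell = levels_{ℓ,m} ∖ levels_{ℓ+1,m}` at a literal `T` with finite fixed type-0 vertex set -/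

section Bridges

variable {K : Type} [Field K] [Valued K ℤᵐ⁰]

/-- `#{x ∈ s ∣ ¬p x} + #{x ∈ s ∣ p x} = #s` for a finite `s` (Mathlib `Set.ncard_inter_add_ncard_sdiff_eq_ncard`). [cite: Laumon1995, Lemma (5.3.2) p. 136] -/
private theorem ncard_sepNot_add_ncard_sep {α : Type*} (s : Set α) (hs : s.Finite) (p : α → Prop) :
    {x | x ∈ s ∧ ¬ p x}.ncard + {x | x ∈ s ∧ p x}.ncard = s.ncard := by
  have h := Set.ncard_inter_add_ncard_sdiff_eq_ncard s {x | p x} hs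
  rw [add_comm] at h
  exact h

/-- **BRIDGE · `#shell_{ℓ,m} + #levels_{ℓ+1,m} = #levels_{ℓ,m}`** on a finite fixed type-0 vertex set (`|ϖ| ≤ 1`): the shell census `(T − 1)M ⊆ ϖ^ℓ M ⊄ ϖ^{ℓ+1}M,
(T − 1)²M ⊆ ϖ^m M` is the DIFFERENCE of the two nested two-level censuses `levels_{ℓ,m} ⊇ levels_{ℓ+1,m}` (§1 `latticeInLevel_of_succ`; the count side of F0P3a-p01 (g35)'s
`shell_eq_levels_sub`). [cite: Kottwitz1986BaseChangeUnits, §1 pp. 240–241, §3] -/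
theorem ncard_shell_add_ncard_levels_succ_eq_ncard_levels (σ : K →+* K) {ϖ : K} (hϖ1 : Valued.v ϖ ≤ 1) (ℓ m : ℕ) (T : GL (Fin 3) K)
    (hfin : ({M : Submodule (Valued.integer K) (Fin 3 → K) | IsVertexLattice σ ϖ ((StdForm.antidiagonal 3).over K) 0 M ∧ mapGL T M = M}).Finite) :
    {M : Submodule (Valued.integer K) (Fin 3 → K) | IsVertexLattice σ ϖ ((StdForm.antidiagonal 3).over K) 0 M ∧ mapGL T M = M ∧
          LatticeNearTransvShell ϖ ℓ m ((T : Matrix (Fin 3) (Fin 3) K) - 1) M}.ncard +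
        {M : Submodule (Valued.integer K) (Fin 3 → K) | IsVertexLattice σ ϖ ((StdForm.antidiagonal 3).over K) 0 M ∧ mapGL T M = M ∧
          (LatticeInLevel ϖ (ℓ + 1) ((T : Matrix (Fin 3) (Fin 3) K) - 1) M ∧
            LatticeInLevel ϖ m (((T : Matrix (Fin 3) (Fin 3) K) - 1) * ((T : Matrix (Fin 3) (Fin 3) K) - 1)) M)}.ncard =
      {M : Submodule (Valued.integer K) (Fin 3 → K) | IsVertexLattice σ ϖ ((StdForm.antidiagonal 3).over K) 0 M ∧ mapGL T M = M ∧
          (LatticeInLevel ϖ ℓ ((T : Matrix (Fin 3) (Fin 3) K) - 1) M ∧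
            LatticeInLevel ϖ m (((T : Matrix (Fin 3) (Fin 3) K) - 1) * ((T : Matrix (Fin 3) (Fin 3) K) - 1)) M)}.ncard := by
  have hfin' : ({M : Submodule (Valued.integer K) (Fin 3 → K) | IsVertexLattice σ ϖ ((StdForm.antidiagonal 3).over K) 0 M ∧ mapGL T M = M ∧
      (LatticeInLevel ϖ ℓ ((T : Matrix (Fin 3) (Fin 3) K) - 1) M ∧
        LatticeInLevel ϖ m (((T : Matrix (Fin 3) (Fin 3) K) - 1) * ((T : Matrix (Fin 3) (Fin 3) K) - 1)) M)}).Finite :=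
    hfin.subset fun M hM => ⟨hM.1, hM.2.1⟩
  -- the shell census = the members of `levels_{ℓ,m}` NOT in level `ℓ + 1`
  have e1 : {M : Submodule (Valued.integer K) (Fin 3 → K) | IsVertexLattice σ ϖ ((StdForm.antidiagonal 3).over K) 0 M ∧ mapGL T M = M ∧
        LatticeNearTransvShell ϖ ℓ m ((T : Matrix (Fin 3) (Fin 3) K) - 1) M} =
      {M | M ∈ {M : Submodule (Valued.integer K) (Fin 3 → K) | IsVertexLattice σ ϖ ((StdForm.antidiagonal 3).over K) 0 M ∧ mapGL T M = M ∧
          (LatticeInLevel ϖ ℓ ((T : Matrix (Fin 3) (Fin 3) K) - 1) M ∧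
            LatticeInLevel ϖ m (((T : Matrix (Fin 3) (Fin 3) K) - 1) * ((T : Matrix (Fin 3) (Fin 3) K) - 1)) M)} ∧
        ¬ LatticeInLevel ϖ (ℓ + 1) ((T : Matrix (Fin 3) (Fin 3) K) - 1) M} := by
    ext M
    simp only [Set.mem_setOf_eq, LatticeNearTransvShell]
    constructor
    · rintro ⟨h0, hT, hℓ, hℓ1, hm⟩
      exact ⟨⟨h0, hT, hℓ, hm⟩, hℓ1⟩
    · rintro ⟨⟨h0, hT, hℓ, hm⟩, hℓ1⟩
      exact ⟨h0, hT, hℓ, hℓ1, hm⟩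
  -- the census `levels_{ℓ+1,m}` = the members of `levels_{ℓ,m}` IN level `ℓ + 1` (antitonicity)
  have e2 : {M : Submodule (Valued.integer K) (Fin 3 → K) | IsVertexLattice σ ϖ ((StdForm.antidiagonal 3).over K) 0 M ∧ mapGL T M = M ∧
        (LatticeInLevel ϖ (ℓ + 1) ((T : Matrix (Fin 3) (Fin 3) K) - 1) M ∧
          LatticeInLevel ϖ m (((T : Matrix (Fin 3) (Fin 3) K) - 1) * ((T : Matrix (Fin 3) (Fin 3) K) - 1)) M)} =
      {M | M ∈ {M : Submodule (Valued.integer K) (Fin 3 → K) | IsVertexLattice σ ϖ ((StdForm.antidiagonal 3).over K) 0 M ∧ mapGL T M = M ∧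
          (LatticeInLevel ϖ ℓ ((T : Matrix (Fin 3) (Fin 3) K) - 1) M ∧
            LatticeInLevel ϖ m (((T : Matrix (Fin 3) (Fin 3) K) - 1) * ((T : Matrix (Fin 3) (Fin 3) K) - 1)) M)} ∧
        LatticeInLevel ϖ (ℓ + 1) ((T : Matrix (Fin 3) (Fin 3) K) - 1) M} := by
    ext M
    simp only [Set.mem_setOf_eq]
    constructor
    · rintro ⟨h0, hT, hℓ1, hm⟩
      exact ⟨⟨h0, hT, latticeInLevel_of_succ hϖ1 hℓ1, hm⟩, hℓ1⟩
    · rintro ⟨⟨h0, hT, -, hm⟩, hℓ1⟩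
      exact ⟨h0, hT, hℓ1, hm⟩
  rw [e1, e2]
  exact ncard_sepNot_add_ncard_sep _ hfin' _

end Bridges

end Summit.HodgeConjecture.HodgeConjecture.Cruxes.H413.F0P3cDyRamLevelsPieceCountDictionary

end
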